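import Mathlib
import Summits.QuantumFields.YangMills.Theses.CoarseStiffnessTail
import Summits.QuantumFields.YangMills.Theorems.CoarseStiffnessTailUnitPolyTailLAbsorbRate
import Literature.MathematicalPhysics.QuantumFieldTheory.Balaban1983to89.T4PairDerivBridge

/-!
# Route `CoarseStiffnessTail` (rev 1 «unit-poly-tail») — deciding crux `UnitPolyTailL` (stmt-QuantumFields-24027): THE WEAKEST CLOSING
# CURRENCIES AT THE UNIT SCALE — a Weibull tail `exp(−c·p(√γ)^δ)` with ANY `δ > 0`, ONE stretched-exponential moment, or
# polynomial-power MOMENT GROWTH `(C(n+1)^α)^n` with ANY `α`, each uniform in the cut-off, already gives the crux BY NAME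

Prover seat `ym-line-cst-p1` (g30; helper `--supports stmt-QuantumFields-24027`, no item is closed).  Notation: run `K` of the family `F`
(block size `L`, volume exponent `m`), Wilson–Gibbs law `Gibbs_K` at `β_K = (γL^{-K})⁻¹` on the finest lattice, `Ū^K` the `K`-fold
(0.4)-block-averaged field on the UNIT lattice, `a` a unit plaquette, `p = B10.pFun b₀ p₀` ([Balaban1985UV3] (7) p.257), unit-scale threshold
`θ_γ(0) = θBal L γ b₀ p₀ 0 = √γ·p(√γ)`.  The crux S1_poly = `UnitPolyTailL` asks `Gibbs_K{θ_γ(0) ≤ |Ū^K(∂a) − 1|} ≤ C·γ^s` for SOME `s > 3` at a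
profile `(b₀, p₀)` OF THE PROVER'S CHOOSING beyond prescribed thresholds, uniformly in `(K, m, γ ≤ γ₁)`.

WHAT IS PROVED (kernel-checked; unconditional lemmas + CONDITIONAL suppliers of the crux by name).
* §1 abstract probability: Markov at every order (`measureReal_le_moment_div`); MARKOV AT THE OPTIMAL ORDER (`measureReal_le_exp_of_momentGrowth`:
  moments `∫(f²/γ)^n ≤ (C(n+1)^α)^n` for all `n` ⇒ `μ{θ ≤ f} ≤ e²·exp(−(θ²/γ/(eC))^{1/α})`); exponential Chebyshev (`measureReal_le_exp_of_expMoment`).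
* §2 `weibull_absorb` — the LINE-20 absorption stub with the Gaussian exponent `2` replaced by ANY `δ` with `δ·p₀ > 1`:
  `C·γ^(−A)·exp(−c·p(√γ)^δ) ≤ C·γ⁴` for small `γ`; `degradedGaussian_le_weibull_two` — the organ's degraded-Gaussian format (`−c·p² + κ·v^q`,
  `q < 2p₀`) is inside the Weibull currency with `δ = 2`.
* §3 `θ_γ(0) = √γ·p(√γ) > 0`, `θ_γ(0)²/γ = p(√γ)²`; THE CURRENCIES, each ⇒ `UnitPolyTailL` BY NAME, every hypothesis quantified `∀ K` after its constants (uniform in cut-off AND volume):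
  (W) `unitPolyTailL_of_weibullTop` — top-slice tail `≤ C·γ^(−A)·exp(−c·p(√γ)^δ)` at a profile with `δ·p₀ > 1`;
  (O) `unitPolyTailL_of_stretchedExpMomentTop` — `∫ exp(λ·(|Ū^K(∂a)−1|²/γ)^β) dGibbs_K ≤ M` for SOME `β > 0`, `λ > 0`, NO profile (`β = 1` would be the
      Gaussian-rate exponential moment of the rev-0 EDGE stub S1_top — not needed);
  (M) `unitPolyTailL_of_momentGrowthTop` — `∫ (|Ū^K(∂a)−1|²/γ)^n dGibbs_K ≤ (C·(n+1)^α)^n` for all `n`, SOME `α > 0` (Gaussian growth is `α = 1`;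
      `α = 10` closes the crux just as well); and the organ's all-`K` format (`unitPolyTailL_of_degradedGaussianTop`) as the case `δ = 2` of (W).
  In (O)/(M) the profile is manufactured in the proof (`p₀ := max p₁ (max 3 β⁻¹)`, resp. `max p₁ (max 3 α)`) — exactly the freedom the crux grants
  and the rev-0 statement `CappedCoarseStiffnessL` (∀ profile, ONE Gaussian rate) does not.

READING (for planners / a siege).  At the threshold `θ_γ(0)` the natural-scale variable `X = |Ū^K(∂a) − 1|²/γ` is tested at the POLYLOGARITHMIC level
`p(√γ)² = b₀²(1 + ½log γ⁻¹)^{2p₀}`.  Hence (i) finitely many moments of `X`, however uniform, give only a polylogarithmic tail — never `γ^s` (the seat's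
g22–g26 «moments cancel γ»); (ii) ANY stretched-exponential control of `X` — Weibull shape `δ`, an Orlicz-type moment with exponent `β`, or moment
growth `(Cn^α)^n` — does close, since `exp(−c·(log γ⁻¹)^{δp₀})` is below every power once `δp₀ > 1` and `p₀` is free; (iii) a tail of `X` slower than
every stretched exponential (e.g. `exp(−(log t)²)`) fails the crux for every profile.  So the EXACT currency of stmt-QuantumFields-24027 is «SOME
stretched-exponential concentration of the unit-scale averaged plaquette at its natural scale `√γ`, uniform in `(K, m, γ ≤ γ₁)`» — the Gaussian RATE
of [Balaban1985UV3] (71) is not required, only uniformity.  Devices that output moments (cluster/cumulant expansions, integration-by-parts moment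
recursions, hypercontractive bounds) thus have a precise target: growth `(C(n+1)^α)^n` in `n`, constants uniform in `(K, m)`; nothing here says one exists.

HONEST FRAMING.  Elementary probability and real analysis over the tree's definitions; NO Gibbs integral is estimated, nothing of
[Balaban1985UV3] is proved; the hypotheses (W)/(O)/(M) are NOT proved (they carry the whole cut-off-uniform content); `UnitPolyTailL` (24027),
`CappedCoarseStiffnessL` (25301), `HistoryTailL` (19936) stay OPEN; `YM3TorusSU2` is rung R3 of LADDER-YM — a RECORD rung (existence and
uniqueness of Bałaban's ultraviolet limit on the three-torus), NOT the Clay statement — and is NOT proved; the Yang–Mills mass gap is NOT proved.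

References: [Balaban1985UV3] T. Bałaban, Commun. Math. Phys. **102** (1985) 255–275 ((3) p.256, (7) p.257, (71) p.273); [Balaban1987RG1]
T. Bałaban, Commun. Math. Phys. **109** (1987) 249–301 ((0.4) p.253: the block averaging).
-/

set_option autoImplicit false
noncomputable section

namespace Summit.QuantumFields.YangMills.Theorems.CoarseStiffnessTailUnitPolyTailLMomentGrowth

open MeasureTheory Filter
open Literature.MathematicalPhysics.QuantumFieldTheory.Balaban1983to89
open Literature.MathematicalPhysics.QuantumFieldTheory.Balaban1983to89.T3ContinuumYM3Torus
open Literature.MathematicalPhysics.QuantumFieldTheory.Balaban1983to89.T3UnitScaleTilt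
open Literature.MathematicalPhysics.QuantumFieldTheory.Balaban1983to89.T3UnitLawDensityEML
open Literature.MathematicalPhysics.QuantumFieldTheory.Balaban1983to89.T4Continuum (measurable_iter)
open Summit.QuantumFields.YangMills.Theses.CoarseStiffnessTail (UnitPolyTailL)
open Summit.QuantumFields.YangMills.Theorems.CoarseStiffnessTailUnitPolyTailLAbsorbRate (pFun_sqrt_eq eventually_le_rpow)

/-! ## §1 Markov's inequality at every order and at the optimal order (abstract probability) -/

section Markov

variable {X : Type*} [MeasurableSpace X] (μ : Measure X)

/-- **MARKOV AT ORDER `n`**: for a bounded measurable `f ≥ 0` on a finite measure space, `γ > 0`, `θ > 0` and every `n`,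
`μ{θ ≤ f} ≤ (∫ (f²/γ)^n dμ) / (θ²/γ)^n`. [folklore] -/
theorem measureReal_le_moment_div [IsFiniteMeasure μ] {f : X → ℝ} (hf : Measurable f) (hf0 : ∀ x, 0 ≤ f x)
    {B : ℝ} (hfB : ∀ x, f x ≤ B) {γ θ : ℝ} (hγ : 0 < γ) (hθ : 0 < θ) (n : ℕ) :
    μ.real {x | θ ≤ f x} ≤ (∫ x, (f x ^ 2 / γ) ^ n ∂μ) / (θ ^ 2 / γ) ^ n := by
  have hε : 0 < (θ ^ 2 / γ) ^ n := pow_pos (div_pos (pow_pos hθ 2) hγ) n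
  have hgm : Measurable fun x => (f x ^ 2 / γ) ^ n := ((hf.pow_const 2).div_const γ).pow_const n
  have hg0 : ∀ x, 0 ≤ (f x ^ 2 / γ) ^ n := fun x => pow_nonneg (div_nonneg (sq_nonneg _) hγ.le) n
  have hgB : ∀ x, (f x ^ 2 / γ) ^ n ≤ (B ^ 2 / γ) ^ n := fun x =>
    pow_le_pow_left₀ (div_nonneg (sq_nonneg _) hγ.le)
      (div_le_div_of_nonneg_right (pow_le_pow_left₀ (hf0 x) (hfB x) 2) hγ.le) n
  have hgi : Integrable (fun x => (f x ^ 2 / γ) ^ n) μ :=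
    Integrable.mono' (integrable_const ((B ^ 2 / γ) ^ n)) hgm.aestronglyMeasurable
      (ae_of_all _ fun x => by rw [Real.norm_eq_abs, abs_of_nonneg (hg0 x)]; exact hgB x)
  have hsub : {x | θ ≤ f x} ⊆ {x | (θ ^ 2 / γ) ^ n ≤ (f x ^ 2 / γ) ^ n} := fun x hx =>
    pow_le_pow_left₀ (div_nonneg (sq_nonneg _) hγ.le)
      (div_le_div_of_nonneg_right (pow_le_pow_left₀ hθ.le hx 2) hγ.le) n
  have hmarkov := mul_meas_ge_le_integral_of_nonneg (μ := μ) (ae_of_all _ hg0) hgi ((θ ^ 2 / γ) ^ n)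
  rw [le_div_iff₀ hε, mul_comm]
  exact (mul_le_mul_of_nonneg_left (measureReal_mono hsub) hε.le).trans hmarkov

/-- **MARKOV AT THE OPTIMAL ORDER**: if the moments of `f²/γ` grow at most like a power of the order,
`∫ (f²/γ)^n dμ ≤ (C·(n+1)^α)^n` for every `n` (`C, α > 0`, `μ` a probability measure), then the tail of `f` at `θ > 0` is a
STRETCHED EXPONENTIAL in `θ²/γ`: `μ{θ ≤ f} ≤ e²·exp(−(θ²/γ/(e·C))^{1/α})` (choose `n + 1 = ⌊(θ²/(γeC))^{1/α}⌋`). [folklore] -/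
theorem measureReal_le_exp_of_momentGrowth [IsProbabilityMeasure μ] {f : X → ℝ} (hf : Measurable f)
    (hf0 : ∀ x, 0 ≤ f x) {B : ℝ} (hfB : ∀ x, f x ≤ B) {γ θ C α : ℝ} (hγ : 0 < γ) (hθ : 0 < θ) (hC : 0 < C)
    (hα : 0 < α) (hmom : ∀ n : ℕ, ∫ x, (f x ^ 2 / γ) ^ n ∂μ ≤ (C * ((n : ℝ) + 1) ^ α) ^ n) :
    μ.real {x | θ ≤ f x} ≤ Real.exp 2 * Real.exp (-((θ ^ 2 / γ / (Real.exp 1 * C)) ^ (1 / α))) := by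
  set u : ℝ := θ ^ 2 / γ with hudef
  have hu : 0 < u := div_pos (pow_pos hθ 2) hγ
  have heC : 0 < Real.exp 1 * C := mul_pos (Real.exp_pos 1) hC
  set w : ℝ := (u / (Real.exp 1 * C)) ^ (1 / α) with hwdef
  have hw0 : 0 ≤ w := Real.rpow_nonneg (div_pos hu heC).le _
  have hwα : w ^ α = u / (Real.exp 1 * C) := by
    rw [hwdef, ← Real.rpow_mul (div_pos hu heC).le, one_div_mul_cancel hα.ne', Real.rpow_one]
  set N : ℕ := ⌊w⌋₊ with hNdef
  have hNw : (N : ℝ) ≤ w := Nat.floor_le hw0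
  have hwN : w < (N : ℝ) + 1 := Nat.lt_floor_add_one w
  rcases Nat.eq_zero_or_pos N with hN0 | hNpos
  · -- `w < 1`: the trivial bound `μ ≤ 1 ≤ e²·e^{-w}`
    have hw1 : w < 1 := by have := hwN; rw [hN0] at this; simpa using this
    calc μ.real {x | θ ≤ f x} ≤ 1 := measureReal_le_one
      _ ≤ Real.exp 2 * Real.exp (-w) := by rw [← Real.exp_add]; exact Real.one_le_exp (by linarith)
  · -- `N ≥ 1`: Markov at order `n = N - 1`
    obtain ⟨n, hNn⟩ : ∃ n, N = n + 1 := ⟨N - 1, by omega⟩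
    have hn1 : ((n : ℝ) + 1) = (N : ℝ) := by rw [hNn]; push_cast; ring
    have hbase0 : 0 ≤ C * ((n : ℝ) + 1) ^ α / u := div_nonneg (mul_nonneg hC.le (Real.rpow_nonneg (by positivity) _)) hu.le
    -- `C (n+1)^α / u ≤ 1/e`
    have hbase : C * ((n : ℝ) + 1) ^ α / u ≤ (Real.exp 1)⁻¹ := by
      have h1 : ((n : ℝ) + 1) ^ α ≤ w ^ α := by rw [hn1]; exact Real.rpow_le_rpow (by positivity) hNw hα.le
      rw [hwα] at h1
      rw [div_le_iff₀ hu]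
      have h2 : C * ((n : ℝ) + 1) ^ α ≤ C * (u / (Real.exp 1 * C)) := mul_le_mul_of_nonneg_left h1 hC.le
      have h3 : C * (u / (Real.exp 1 * C)) = (Real.exp 1)⁻¹ * u := by field_simp
      linarith [h2, h3]
    have hM := measureReal_le_moment_div μ hf hf0 hfB hγ hθ n
    have hε : 0 < u ^ n := pow_pos hu n
    calc μ.real {x | θ ≤ f x} ≤ (∫ x, (f x ^ 2 / γ) ^ n ∂μ) / u ^ n := hM
      _ ≤ (C * ((n : ℝ) + 1) ^ α) ^ n / u ^ n := div_le_div_of_nonneg_right (hmom n) hε.le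
      _ = (C * ((n : ℝ) + 1) ^ α / u) ^ n := (div_pow _ _ n).symm
      _ ≤ ((Real.exp 1)⁻¹) ^ n := pow_le_pow_left₀ hbase0 hbase n
      _ = Real.exp (-(n : ℝ)) := by rw [← Real.exp_neg, ← Real.exp_nat_mul]; ring_nf
      _ ≤ Real.exp 2 * Real.exp (-w) := by
          have : w < (n : ℝ) + 1 + 1 := by rw [hn1]; exact hwN
          rw [← Real.exp_add]; exact Real.exp_le_exp.mpr (by linarith)

/-- **EXPONENTIAL CHEBYSHEV**: if `∫ exp(λ·(f²/γ)^β) dμ ≤ M` (`β ≥ 0`), then `μ{θ ≤ f} ≤ M·exp(−λ·(θ²/γ)^β)` for `θ > 0`. [folklore] -/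
theorem measureReal_le_exp_of_expMoment [IsFiniteMeasure μ] {f : X → ℝ} (hf : Measurable f) (hf0 : ∀ x, 0 ≤ f x)
    {B : ℝ} (hfB : ∀ x, f x ≤ B) {γ θ lam β M : ℝ} (hγ : 0 < γ) (hθ : 0 < θ) (hlam : 0 ≤ lam) (hβ : 0 ≤ β)
    (hmom : ∫ x, Real.exp (lam * (f x ^ 2 / γ) ^ β) ∂μ ≤ M) :
    μ.real {x | θ ≤ f x} ≤ M * Real.exp (-(lam * (θ ^ 2 / γ) ^ β)) := by
  set g : X → ℝ := fun x => Real.exp (lam * (f x ^ 2 / γ) ^ β) with hgdef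
  have hε : 0 < Real.exp (lam * (θ ^ 2 / γ) ^ β) := Real.exp_pos _
  have hgm : Measurable g :=
    Real.measurable_exp.comp ((((hf.pow_const 2).div_const γ).pow_const β).const_mul lam)
  have hg0 : ∀ x, 0 ≤ g x := fun x => (Real.exp_pos _).le
  have hmono : ∀ {a b : ℝ}, 0 ≤ a → a ≤ b → Real.exp (lam * (a ^ 2 / γ) ^ β) ≤ Real.exp (lam * (b ^ 2 / γ) ^ β) :=
    fun {a b} ha hab => Real.exp_le_exp.mpr (mul_le_mul_of_nonneg_left
      (Real.rpow_le_rpow (div_nonneg (sq_nonneg _) hγ.le)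
        (div_le_div_of_nonneg_right (pow_le_pow_left₀ ha hab 2) hγ.le) hβ) hlam)
  have hgB : ∀ x, g x ≤ Real.exp (lam * (B ^ 2 / γ) ^ β) := fun x => hmono (hf0 x) (hfB x)
  have hgi : Integrable g μ :=
    Integrable.mono' (integrable_const _) hgm.aestronglyMeasurable
      (ae_of_all _ fun x => by rw [Real.norm_eq_abs, abs_of_nonneg (hg0 x)]; exact hgB x)
  have hsub : {x | θ ≤ f x} ⊆ {x | Real.exp (lam * (θ ^ 2 / γ) ^ β) ≤ g x} := fun x hx => hmono hθ.le hx
  have hmarkov := mul_meas_ge_le_integral_of_nonneg (μ := μ) (ae_of_all _ hg0) hgi (Real.exp (lam * (θ ^ 2 / γ) ^ β))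
  have h1 : Real.exp (lam * (θ ^ 2 / γ) ^ β) * μ.real {x | θ ≤ f x} ≤ M :=
    ((mul_le_mul_of_nonneg_left (measureReal_mono hsub) hε.le).trans hmarkov).trans hmom
  rw [Real.exp_neg, ← div_eq_mul_inv, le_div_iff₀ hε, mul_comm]
  exact h1

end Markov

/-! ## §2 Absorption: a stretched exponential `exp(−c·p(√γ)^δ)` is below every power of `γ` as soon as `δ·p₀ > 1` -/

/-- `0 < γ ≤ exp(−2(v₀ − 1))` gives `v₀ ≤ 1 + ½·log γ⁻¹` (the variable `v = 1 + log(√γ)⁻¹` of the absorption). [folklore] -/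
theorem le_one_add_half_log_inv {v₀ γ : ℝ} (hγ : 0 < γ) (hγle : γ ≤ Real.exp (-(2 * (v₀ - 1)))) :
    v₀ ≤ 1 + Real.log γ⁻¹ / 2 := by
  have h1 := Real.log_le_log hγ hγle
  rw [Real.log_exp] at h1
  rw [Real.log_inv]; linarith

/-- The key real inequality behind the Weibull absorption: for `0 < b₀`, `1 < δ·p₀`, `0 < c` and any `A` there is `v₀ ≥ 1` with
`(A + 4)·(2(v − 1)) ≤ c·(b₀·v^{p₀})^δ` for every `v ≥ v₀` (because `(b₀ v^{p₀})^δ = b₀^δ·v^{p₀δ}` and `p₀δ > 1`). [folklore] -/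
theorem linear_le_rpow_rpow {b₀ p₀ δ c : ℝ} (A : ℝ) (hb₀ : 0 < b₀) (hδp : 1 < δ * p₀) (hc : 0 < c) :
    ∃ v₀ : ℝ, 1 ≤ v₀ ∧ ∀ v : ℝ, v₀ ≤ v → (A + 4) * (2 * (v - 1)) ≤ c * (b₀ * v ^ p₀) ^ δ := by
  set M : ℝ := max (A + 4) 0 with hMdef
  have hM0 : 0 ≤ M := le_max_right _ _
  have hMA : A + 4 ≤ M := le_max_left _ _
  have hcb : 0 < c * b₀ ^ δ := mul_pos hc (Real.rpow_pos_of_pos hb₀ δ)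
  have he : 0 < p₀ * δ - 1 := by rw [mul_comm]; linarith
  have hev : ∀ᶠ v : ℝ in atTop, 1 ≤ v ∧ 2 * M / (c * b₀ ^ δ) ≤ v ^ (p₀ * δ - 1) :=
    (eventually_ge_atTop 1).and (eventually_le_rpow he _)
  obtain ⟨v₁, hv₁⟩ := hev.exists_forall_of_atTop
  refine ⟨max v₁ 1, le_max_right _ _, fun v hv => ?_⟩
  obtain ⟨hv1, hT⟩ := hv₁ v ((le_max_left _ _).trans hv)
  have hv0 : 0 < v := zero_lt_one.trans_le hv1
  -- `(b₀ v^{p₀})^δ = b₀^δ · (v^{p₀δ−1} · v)`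
  have hexp : (b₀ * v ^ p₀) ^ δ = b₀ ^ δ * (v ^ (p₀ * δ - 1) * v) := by
    rw [Real.mul_rpow hb₀.le (Real.rpow_nonneg hv0.le _), ← Real.rpow_mul hv0.le]
    congr 1
    conv_lhs => rw [show p₀ * δ = (p₀ * δ - 1) + 1 by ring]
    rw [Real.rpow_add hv0, Real.rpow_one]
  rw [hexp]
  have h1 : (A + 4) * (2 * (v - 1)) ≤ M * (2 * (v - 1)) := mul_le_mul_of_nonneg_right hMA (by linarith)
  have h2 : M * (2 * (v - 1)) ≤ 2 * M * v := by nlinarith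
  have h3 : 2 * M * v ≤ c * (b₀ ^ δ * (v ^ (p₀ * δ - 1) * v)) := by
    rw [div_le_iff₀ hcb] at hT
    have h4 : c * (b₀ ^ δ * (v ^ (p₀ * δ - 1) * v)) = (v ^ (p₀ * δ - 1) * (c * b₀ ^ δ)) * v := by ring
    rw [h4]
    exact mul_le_mul_of_nonneg_right hT hv0.le
  linarith

/-- **WEIBULL ABSORPTION** (generalises the LINE-20 stub `stub_absorbRate`, exponent `2 ↦ δ`): for `0 < b₀`, `1 < δ·p₀`, `0 < c`, `0 ≤ C`
and any `A`, the stretched-exponential large-field format `C·γ^(−A)·exp(−c·p(√γ)^δ)` (`p = B10.pFun b₀ p₀`, [Balaban1985UV3] (7) p.257: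
`p(g) = b₀(1 + log g⁻¹)^{p₀}`) is below `C'·γ^s` with `s = 4 > 3` for all `0 < γ ≤ γ₀`: with `v = 1 + ½log γ⁻¹`, `p(√γ)^δ = b₀^δ·v^{δp₀}` beats
`(A + 4)·log γ⁻¹ = (A + 4)·2(v − 1)` exactly because `δ·p₀ > 1`.  Pure real analysis. [cite: Balaban1985UV3, (7) p.257] -/
theorem weibull_absorb {b₀ p₀ δ c : ℝ} (A C : ℝ) (hb₀ : 0 < b₀) (hδp : 1 < δ * p₀) (hc : 0 < c) (hC : 0 ≤ C) :
    ∃ (s C' γ₀ : ℝ), 3 < s ∧ 0 ≤ C' ∧ 0 < γ₀ ∧ γ₀ ≤ 1 ∧ ∀ γ : ℝ, 0 < γ → γ ≤ γ₀ →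
      C * γ ^ (-A) * Real.exp (-(c * B10.pFun b₀ p₀ (Real.sqrt γ) ^ δ)) ≤ C' * γ ^ s := by
  obtain ⟨v₀, hv₀1, hv₀⟩ := linear_le_rpow_rpow A hb₀ hδp hc
  refine ⟨4, C, Real.exp (-(2 * (v₀ - 1))), by norm_num, hC, Real.exp_pos _,
    by rw [Real.exp_le_one_iff]; linarith, fun γ hγ hγle => ?_⟩
  set v : ℝ := 1 + Real.log γ⁻¹ / 2 with hvdef
  have hlogγ : Real.log γ = -(2 * (v - 1)) := by rw [hvdef, Real.log_inv]; ring
  have hp : B10.pFun b₀ p₀ (Real.sqrt γ) = b₀ * v ^ p₀ := by rw [pFun_sqrt_eq hγ, hvdef]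
  rw [hp, Real.rpow_def_of_pos hγ, Real.rpow_def_of_pos hγ, hlogγ, mul_assoc, ← Real.exp_add]
  refine mul_le_mul_of_nonneg_left (Real.exp_le_exp.mpr ?_) hC
  have key := hv₀ v (le_one_add_half_log_inv hγ hγle)
  nlinarith [key]

/-- **THE ORGAN'S CURRENCY IS INSIDE (W) WITH `δ = 2`**: for `0 < b₀`, `2 < p₀`, `0 < c`, `q < 2p₀`, `0 ≤ C` and any `κ`, `A`, the
degraded-Gaussian format of LINE 20's `stub_topTailDegradedEv` is eventually below the Weibull format with exponent `2` and half the rate: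
`C·γ^(−A)·exp(−c·p(√γ)² + κ·(1 + log(√γ)⁻¹)^q) ≤ C·γ^(−A)·exp(−(c/2)·p(√γ)^2)` for `0 < γ ≤ γ₀` (the collar term `κ v^q` is absorbed by half the
Gaussian exponent because `q < 2p₀`; `linear_add_rpow_le_sq` of the absorption file with `A = −4`). Pure real analysis. [cite: Balaban1985UV3, (7) p.257 and (39) p.266] -/
theorem degradedGaussian_le_weibull_two {b₀ p₀ c q : ℝ} (κ A C : ℝ) (hb₀ : 0 < b₀) (hp₀ : 2 < p₀) (hc : 0 < c) (hq : q < 2 * p₀)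
    (hC : 0 ≤ C) :
    ∃ γ₀ : ℝ, 0 < γ₀ ∧ γ₀ ≤ 1 ∧ ∀ γ : ℝ, 0 < γ → γ ≤ γ₀ →
      C * γ ^ (-A) * Real.exp (-(c * B10.pFun b₀ p₀ (Real.sqrt γ) ^ 2) + κ * (1 + Real.log (Real.sqrt γ)⁻¹) ^ q) ≤
        C * γ ^ (-A) * Real.exp (-(c / 2 * B10.pFun b₀ p₀ (Real.sqrt γ) ^ (2 : ℝ))) := by
  obtain ⟨v₀, hv₀1, hv₀⟩ :=
    CoarseStiffnessTailUnitPolyTailLAbsorbRate.linear_add_rpow_le_sq κ (-4) hb₀ hp₀ (half_pos hc) hq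
  refine ⟨Real.exp (-(2 * (v₀ - 1))), Real.exp_pos _, by rw [Real.exp_le_one_iff]; linarith, fun γ hγ hγle => ?_⟩
  set v : ℝ := 1 + Real.log γ⁻¹ / 2 with hvdef
  have hx : 1 + Real.log (Real.sqrt γ)⁻¹ = v := by
    rw [Real.log_inv, Real.log_sqrt hγ.le, hvdef, Real.log_inv]; ring
  have hp : B10.pFun b₀ p₀ (Real.sqrt γ) = b₀ * v ^ p₀ := by rw [pFun_sqrt_eq hγ, hvdef]
  have h2 : (b₀ * v ^ p₀) ^ (2 : ℝ) = (b₀ * v ^ p₀) ^ (2 : ℕ) := by rw [← Real.rpow_natCast]; norm_num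
  rw [hx, hp, h2]
  refine mul_le_mul_of_nonneg_left (Real.exp_le_exp.mpr ?_) (mul_nonneg hC (Real.rpow_nonneg hγ.le _))
  have key := hv₀ v (le_one_add_half_log_inv hγ hγle)
  norm_num at key
  linarith

/-! ## §3 The unit-scale threshold `θ_γ(0) = √γ·p(√γ)`; the currencies, each ⇒ `UnitPolyTailL` (stmt-QuantumFields-24027) BY NAME -/

/-- `θBal L γ b₀ p₀ 0 = √γ·p(√γ)` (no `L`-dependence at the unit scale). [cite: Balaban1985UV3, (3) p.256 and (7) p.257] -/
theorem θBal_zero_eq (L : ℕ) (γ b₀ p₀ : ℝ) : θBal L γ b₀ p₀ 0 = Real.sqrt γ * B10.pFun b₀ p₀ (Real.sqrt γ) := by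
  simp [θBal]

/-- `p(√γ) > 0` for `0 < γ ≤ 1`, `0 < b₀` (the base `1 + log(√γ)⁻¹ ≥ 1`). [cite: Balaban1985UV3, (7) p.257] -/
theorem pFun_sqrt_pos {γ b₀ : ℝ} (p₀ : ℝ) (hγ : 0 < γ) (hγ1 : γ ≤ 1) (hb₀ : 0 < b₀) : 0 < B10.pFun b₀ p₀ (Real.sqrt γ) := by
  have hlog : 0 ≤ Real.log (Real.sqrt γ)⁻¹ :=
    Real.log_nonneg ((one_le_inv₀ (Real.sqrt_pos.mpr hγ)).mpr (Real.sqrt_le_one.mpr hγ1))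
  exact mul_pos hb₀ (Real.rpow_pos_of_pos (by linarith) _)

/-- `θ_γ(0) > 0` for `0 < γ ≤ 1`, `0 < b₀`. [cite: Balaban1985UV3, (7) p.257] -/
theorem θBal_zero_pos (L : ℕ) {γ b₀ : ℝ} (p₀ : ℝ) (hγ : 0 < γ) (hγ1 : γ ≤ 1) (hb₀ : 0 < b₀) : 0 < θBal L γ b₀ p₀ 0 := by
  rw [θBal_zero_eq]; exact mul_pos (Real.sqrt_pos.mpr hγ) (pFun_sqrt_pos p₀ hγ hγ1 hb₀)

/-- `θ_γ(0)²/γ = p(√γ)²`: the natural-scale variable `|Ū^K(∂a) − 1|²/γ` is tested at the level `p(√γ)²` (`β·θ² = p(g)²`). [cite: Balaban1985UV3, (7) p.257] -/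
theorem θBal_zero_sq_div (L : ℕ) {γ : ℝ} (hγ : 0 < γ) (b₀ p₀ : ℝ) :
    θBal L γ b₀ p₀ 0 ^ 2 / γ = B10.pFun b₀ p₀ (Real.sqrt γ) ^ 2 := by
  rw [θBal_zero_eq, mul_pow, Real.sq_sqrt hγ.le]; field_simp

section Suppliers

variable (F : T3Family)

/-- `U ↦ |Ū^{K}(∂a) − 1|` is measurable (measurable (0.4)-averagings for the measurable `ℰp`, measurable plaquette variable, measurable `dist1`).
[cite: Balaban1987RG1, (0.4) p.253] -/
theorem measurable_dist1_top (K : ℕ) (a : Plaq (F.P K) K) :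
    Measurable fun U : GaugeField (F.P K) 0 (Matrix.specialUnitaryGroup (Fin 2) ℂ) =>
      GaugeGroup.dist1 (GaugeField.plaqHol (Averaging.iter (fun i => BlockAveraging.blockAvg (P := F.P K) (j := i) ℰp) K U) a) :=
  RegularGaugeGroup.measurable_dist1.comp ((Missing.measurable_plaqHol a).comp
    (measurable_iter _ (F.avgMeasurable_of_measurableE ℰp measurableE_ℰp K) K))

variable {F}

/-- ★ **CURRENCY (W) — WEIBULL TAIL AT THE UNIT-SCALE THRESHOLD ⇒ `UnitPolyTailL`**: if for every `L`, `(b₁, p₁)` there are a profile `(b₀, p₀)` beyond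
them, `δ > 0` WITH `δ·p₀ > 1`, `c > 0`, `A`, `C ≥ 0`, `γ₁ ∈ (0,1]` with `Gibbs_K{θ_γ(0) ≤ |Ū^K(∂a) − 1|} ≤ C·γ^(−A)·exp(−c·p(√γ)^δ)` for every family `F`
(`F.L = L`), `0 < γ ≤ γ₁`, EVERY cut-off `K` and unit plaquette `a`, then `UnitPolyTailL` (`weibull_absorb`).  LINE 20's organ is the case `δ = 2`; ANY
`δ > 0` is admissible because `p₀` is the prover's (`p₀ > 1/δ`).  CONDITIONAL: the hypothesis is NOT proved. [cite: Balaban1985UV3, (7) p.257 and (71) p.273] -/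
theorem unitPolyTailL_of_weibullTop
    (h : ∀ (L : ℕ) (b₁ p₁ : ℝ), ∃ (b₀ p₀ : ℝ), b₁ ≤ b₀ ∧ p₁ ≤ p₀ ∧ 0 < b₀ ∧ 2 < p₀ ∧
      ∃ (δ c A C γ₁ : ℝ), 0 < δ ∧ 1 < δ * p₀ ∧ 0 < c ∧ 0 ≤ C ∧ 0 < γ₁ ∧ γ₁ ≤ 1 ∧
        ∀ (F : T3Family) (γ : ℝ), F.L = L → 0 < γ → γ ≤ γ₁ → ∀ (K : ℕ) (a : Plaq (F.P K) K),
          (gibbsK F ℰp γ K).real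
              {U | θBal F.L γ b₀ p₀ 0 ≤ GaugeGroup.dist1 (GaugeField.plaqHol
                (Averaging.iter (fun i => BlockAveraging.blockAvg (P := F.P K) (j := i) ℰp) K U) a)} ≤
            C * γ ^ (-A) * Real.exp (-(c * B10.pFun b₀ p₀ (Real.sqrt γ) ^ δ))) :
    UnitPolyTailL := by
  intro L b₁ p₁
  obtain ⟨b₀, p₀, hb₁, hp₁, hb₀, hp₀, δ, c, A, C, γ₁, -, hδp, hc, hC, hγ₁, hγ₁1, hT⟩ := h L b₁ p₁
  obtain ⟨s, C', γ₀, hs, hC', hγ₀, -, hR⟩ := weibull_absorb A C hb₀ hδp hc hC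
  refine ⟨b₀, p₀, hb₁, hp₁, hb₀, hp₀, s, C', min γ₁ γ₀, hs, hC', lt_min hγ₁ hγ₀, (min_le_left _ _).trans hγ₁1,
    fun F γ hFL hγ hγle K a => ?_⟩
  exact (hT F γ hFL hγ (hγle.trans (min_le_left _ _)) K a).trans (hR γ hγ (hγle.trans (min_le_right _ _)))

/-- ★★ **CURRENCY (O) — ONE STRETCHED-EXPONENTIAL MOMENT AT THE NATURAL SCALE ⇒ `UnitPolyTailL`**: if for every `L` there are `β > 0`, `λ > 0`, `M`,
`γ₁ ∈ (0,1]` with `∫ exp(λ·(|Ū^K(∂a) − 1|²/γ)^β) dGibbs_K ≤ M` for every family `F` (`F.L = L`), `0 < γ ≤ γ₁`, EVERY cut-off `K` and unit plaquette `a` —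
NO profile, NO Gaussian rate (`β = 1` would be the exponential moment of the rev-0 EDGE stub S1_top; any `β > 0`, e.g. `1/10`, suffices) — then
`UnitPolyTailL`: exponential Chebyshev gives the Weibull tail `δ = 2β` at every profile, and `p₀ := max p₁ (max 3 β⁻¹)` has `δ·p₀ ≥ 2`.  CONDITIONAL:
the hypothesis is NOT proved. [cite: Balaban1985UV3, (7) p.257 and (71) p.273] -/
theorem unitPolyTailL_of_stretchedExpMomentTop
    (h : ∀ L : ℕ, ∃ (β lam M γ₁ : ℝ), 0 < β ∧ 0 < lam ∧ 0 < γ₁ ∧ γ₁ ≤ 1 ∧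
      ∀ (F : T3Family) (γ : ℝ), F.L = L → 0 < γ → γ ≤ γ₁ → ∀ (K : ℕ) (a : Plaq (F.P K) K),
        ∫ U, Real.exp (lam * (GaugeGroup.dist1 (GaugeField.plaqHol
            (Averaging.iter (fun i => BlockAveraging.blockAvg (P := F.P K) (j := i) ℰp) K U) a) ^ 2 / γ) ^ β)
          ∂(gibbsK F ℰp γ K) ≤ M) :
    UnitPolyTailL := by
  refine unitPolyTailL_of_weibullTop fun L b₁ p₁ => ?_
  obtain ⟨β, lam, M, γ₁, hβ, hlam, hγ₁, hγ₁1, hI⟩ := h L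
  have hb₀ : 0 < max b₁ 1 := lt_of_lt_of_le one_pos (le_max_right _ _)
  have hp₀ : (2 : ℝ) < max p₁ (max 3 β⁻¹) := lt_of_lt_of_le (by norm_num) ((le_max_left _ _).trans (le_max_right _ _))
  have hδp : 1 < (2 * β) * max p₁ (max 3 β⁻¹) := by
    have h1 : β⁻¹ ≤ max p₁ (max 3 β⁻¹) := (le_max_right _ _).trans (le_max_right _ _)
    have h2 : (2 * β) * β⁻¹ = 2 := by field_simp
    nlinarith [mul_le_mul_of_nonneg_left h1 (by positivity : (0 : ℝ) ≤ 2 * β)]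
  -- `M ≥ 0` is forced by the hypothesis at any admissible point; we only need it for the format, so take `max M 0`
  refine ⟨max b₁ 1, max p₁ (max 3 β⁻¹), le_max_left _ _, le_max_left _ _, hb₀, hp₀, 2 * β, lam, 0, max M 0, γ₁,
    by positivity, hδp, hlam, le_max_right _ _, hγ₁, hγ₁1, fun F γ hFL hγ hγle K a => ?_⟩
  have hγ1 : γ ≤ 1 := hγle.trans hγ₁1
  haveI := isProbabilityMeasure_gibbsK F ℰp hγ.le K
  have hθ := θBal_zero_pos F.L (max p₁ (max 3 β⁻¹)) hγ hγ1 hb₀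
  have key := measureReal_le_exp_of_expMoment (gibbsK F ℰp γ K) (measurable_dist1_top F K a)
    (fun U => GaugeGroup.dist1_nonneg _) (fun U => T4PairDerivBridge.dist1_le_two_specialUnitaryGroup _) hγ hθ hlam.le hβ.le
    ((hI F γ hFL hγ hγle K a).trans (le_max_left M 0))
  rw [θBal_zero_sq_div F.L hγ] at key
  have hp0 : 0 ≤ B10.pFun (max b₁ 1) (max p₁ (max 3 β⁻¹)) (Real.sqrt γ) := (pFun_sqrt_pos _ hγ hγ1 hb₀).le
  have hpow : (B10.pFun (max b₁ 1) (max p₁ (max 3 β⁻¹)) (Real.sqrt γ) ^ 2) ^ β =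
      B10.pFun (max b₁ 1) (max p₁ (max 3 β⁻¹)) (Real.sqrt γ) ^ (2 * β) := by
    rw [← Real.rpow_natCast _ 2, ← Real.rpow_mul hp0]
    norm_num
  rw [hpow] at key
  simpa only [neg_zero, Real.rpow_zero, mul_one] using key

/-- ★★★ **CURRENCY (M) — POLYNOMIAL-POWER MOMENT GROWTH AT THE NATURAL SCALE ⇒ `UnitPolyTailL`**: if for every `L` there are `α > 0`, `C > 0`,
`γ₁ ∈ (0,1]` with `∫ (|Ū^K(∂a) − 1|²/γ)^n dGibbs_K ≤ (C·(n + 1)^α)^n` for EVERY `n : ℕ`, every family `F` (`F.L = L`), `0 < γ ≤ γ₁`, EVERY cut-off `K` and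
unit plaquette `a`, then `UnitPolyTailL`: Markov at the optimal order `n + 1 = ⌊(p(√γ)²/(eC))^{1/α}⌋` gives the Weibull tail
`e²·exp(−(eC)^{−1/α}·p(√γ)^{2/α})` (`δ = 2/α`) and `p₀ := max p₁ (max 3 α)` has `δ·p₀ ≥ 2`.  Fixed-order moments give only a polylogarithmic tail
(`θ_γ(0)²/γ = p(√γ)²`); growth of ANY polynomial power in the order — Gaussian is `α = 1`, `α = 10` is as good — closes the crux.  CONDITIONAL: the
hypothesis is NOT proved. [cite: Balaban1985UV3, (7) p.257 and (71) p.273] -/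
theorem unitPolyTailL_of_momentGrowthTop
    (h : ∀ L : ℕ, ∃ (α C γ₁ : ℝ), 0 < α ∧ 0 < C ∧ 0 < γ₁ ∧ γ₁ ≤ 1 ∧
      ∀ (F : T3Family) (γ : ℝ), F.L = L → 0 < γ → γ ≤ γ₁ → ∀ (K : ℕ) (a : Plaq (F.P K) K) (n : ℕ),
        ∫ U, (GaugeGroup.dist1 (GaugeField.plaqHol
            (Averaging.iter (fun i => BlockAveraging.blockAvg (P := F.P K) (j := i) ℰp) K U) a) ^ 2 / γ) ^ n
          ∂(gibbsK F ℰp γ K) ≤ (C * ((n : ℝ) + 1) ^ α) ^ n) :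
    UnitPolyTailL := by
  refine unitPolyTailL_of_weibullTop fun L b₁ p₁ => ?_
  obtain ⟨α, C, γ₁, hα, hC, hγ₁, hγ₁1, hI⟩ := h L
  have heC : 0 < Real.exp 1 * C := mul_pos (Real.exp_pos 1) hC
  have hb₀ : 0 < max b₁ 1 := lt_of_lt_of_le one_pos (le_max_right _ _)
  have hp₀ : (2 : ℝ) < max p₁ (max 3 α) := lt_of_lt_of_le (by norm_num) ((le_max_left _ _).trans (le_max_right _ _))
  have hδp : 1 < (2 * (1 / α)) * max p₁ (max 3 α) := by
    have h1 : α ≤ max p₁ (max 3 α) := (le_max_right _ _).trans (le_max_right _ _)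
    have h2 : (2 * (1 / α)) * α = 2 := by field_simp
    nlinarith [mul_le_mul_of_nonneg_left h1 (by positivity : (0 : ℝ) ≤ 2 * (1 / α))]
  refine ⟨max b₁ 1, max p₁ (max 3 α), le_max_left _ _, le_max_left _ _, hb₀, hp₀, 2 * (1 / α),
    ((Real.exp 1 * C) ^ (1 / α))⁻¹, 0, Real.exp 2, γ₁, by positivity, hδp,
    inv_pos.mpr (Real.rpow_pos_of_pos heC _), (Real.exp_pos 2).le, hγ₁, hγ₁1, fun F γ hFL hγ hγle K a => ?_⟩
  have hγ1 : γ ≤ 1 := hγle.trans hγ₁1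
  haveI := isProbabilityMeasure_gibbsK F ℰp hγ.le K
  have hθ := θBal_zero_pos F.L (max p₁ (max 3 α)) hγ hγ1 hb₀
  have key := measureReal_le_exp_of_momentGrowth (gibbsK F ℰp γ K) (measurable_dist1_top F K a)
    (fun U => GaugeGroup.dist1_nonneg _) (fun U => T4PairDerivBridge.dist1_le_two_specialUnitaryGroup _) hγ hθ hC hα (fun n => hI F γ hFL hγ hγle K a n)
  rw [θBal_zero_sq_div F.L hγ] at key
  have hp0 : 0 ≤ B10.pFun (max b₁ 1) (max p₁ (max 3 α)) (Real.sqrt γ) := (pFun_sqrt_pos _ hγ hγ1 hb₀).le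
  have hpow : (B10.pFun (max b₁ 1) (max p₁ (max 3 α)) (Real.sqrt γ) ^ 2 / (Real.exp 1 * C)) ^ (1 / α) =
      ((Real.exp 1 * C) ^ (1 / α))⁻¹ * B10.pFun (max b₁ 1) (max p₁ (max 3 α)) (Real.sqrt γ) ^ (2 * (1 / α)) := by
    rw [Real.div_rpow (sq_nonneg _) heC.le, ← Real.rpow_natCast _ 2, ← Real.rpow_mul hp0, div_eq_inv_mul]
    norm_num
  rw [hpow] at key
  simpa only [neg_zero, Real.rpow_zero, mul_one] using key

/-- **THE ORGAN'S FORMAT AT EVERY CUT-OFF ⇒ `UnitPolyTailL` THROUGH (W)** (LINE 20's degraded-Gaussian currency is the case `δ = 2` of (W); the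
registered organ `stub_topTailDegradedEv` asks it only for `K > K₀` plus bounded-cut-off slices — this all-`K` form is for comparison only):
`degradedGaussian_le_weibull_two` + `unitPolyTailL_of_weibullTop` (`δ·p₀ = 2p₀ > 4`).  CONDITIONAL. [cite: Balaban1985UV3, (39) p.266 and (71) p.273] -/
theorem unitPolyTailL_of_degradedGaussianTop
    (h : ∀ (L : ℕ) (b₁ p₁ : ℝ), ∃ (b₀ p₀ : ℝ), b₁ ≤ b₀ ∧ p₁ ≤ p₀ ∧ 0 < b₀ ∧ 2 < p₀ ∧
      ∃ (c κ q A C γ₁ : ℝ), 0 < c ∧ q < 2 * p₀ ∧ 0 ≤ C ∧ 0 < γ₁ ∧ γ₁ ≤ 1 ∧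
        ∀ (F : T3Family) (γ : ℝ), F.L = L → 0 < γ → γ ≤ γ₁ → ∀ (K : ℕ) (a : Plaq (F.P K) K),
          (gibbsK F ℰp γ K).real
              {U | θBal F.L γ b₀ p₀ 0 ≤ GaugeGroup.dist1 (GaugeField.plaqHol
                (Averaging.iter (fun i => BlockAveraging.blockAvg (P := F.P K) (j := i) ℰp) K U) a)} ≤
            C * γ ^ (-A) * Real.exp (-(c * B10.pFun b₀ p₀ (Real.sqrt γ) ^ 2) + κ * (1 + Real.log (Real.sqrt γ)⁻¹) ^ q)) :
    UnitPolyTailL := by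
  refine unitPolyTailL_of_weibullTop fun L b₁ p₁ => ?_
  obtain ⟨b₀, p₀, hb₁, hp₁, hb₀, hp₀, c, κ, q, A, C, γ₁, hc, hq, hC, hγ₁, hγ₁1, hT⟩ := h L b₁ p₁
  obtain ⟨γ₀, hγ₀, -, hcmp⟩ := degradedGaussian_le_weibull_two κ A C hb₀ hp₀ hc hq hC
  refine ⟨b₀, p₀, hb₁, hp₁, hb₀, hp₀, 2, c / 2, A, C, min γ₁ γ₀, two_pos, by linarith, half_pos hc, hC, lt_min hγ₁ hγ₀,
    (min_le_left _ _).trans hγ₁1, fun F γ hFL hγ hγle K a => ?_⟩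
  exact (hT F γ hFL hγ (hγle.trans (min_le_left _ _)) K a).trans (hcmp γ hγ (hγle.trans (min_le_right _ _)))

end Suppliers

end Summit.QuantumFields.YangMills.Theorems.CoarseStiffnessTailUnitPolyTailLMomentGrowth

end
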